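import Summits.ResolutionOfSingularities.ResolutionOfSingularities.Theorems.HilbertSamuelEliminationCampaignW42RidgeDimMonotone
import Summits.ResolutionOfSingularities.ResolutionOfSingularities.Theorems.HilbertSamuelEliminationSigmaMaxModificationsCorridor3WMono
import HarnessLib

/-!
# [OURS · L1 W4.2] `ē` DOES NOT INCREASE AT NEAR POINTS — UNCONDITIONALLY: `ē_{x'}(X') ≤ ē_x(X)` at every near point of a
# permissible blow-up (no closedness, no level bound, no binder), hence the s42 assembly hypothesis
# `CampaignW42.GeomDirDimNonincrease p`, the w42 row `ClosedOriginGeomDirDimNonincrease p N` and the content of the registered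
# stub `stub_Wmono` hold for every `p` with NO named fact (campaign s42, cell res-hironaka; `--supports`)

HONEST FRAMING. OURS (slot W4.2, prover res-L1-s42-pv-1, gen 5). The tree held these three statements MODULO the printed binder
CJS Thm. 3.10 (4) (`CossartJannsenSaito2020_thm_3_10_4`: `closedOriginGeomDirDimNonincrease_of_thm_3_10_4`,
`stub_Wmono_of_thm_3_10_4`, `geomDirDimNonincrease_of_thm_3_10_4`, file `…SigmaMaxModificationsCorridor3WMono`). The binder was used
only through `geomDirDim_le_of_hsFun_eq_of_isClosed` (`ē_{x'} ≤ ē_x` at a CLOSED near point). This file proves that inequality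
outright and more — at EVERY near point, from the unconditional ridge monotonicity `ridgeDimDropAt_of_isNearPoint`
(`…CampaignW42RidgeDimMonotone`, this generation: Dietel (8.2.7) (ii) for Giraud's ridge) and `dim F = ē` (`ridgeDim_eq_geomDirDim`,
F-56 discharged) — and re-runs the three short assemblies of `…Corridor3WMono` without the binder:

* `geomDirDim_le_of_isNearPoint` — `ē_{x'}(X') ≤ ē_{π x'}(X)` (`X` with universally catenary local ring at `π x'`, `D` permissible
  there, `π` a blow-up in `D`, `H^N_{X'}(x') = H^N_X(π x')` for SOME `N`);
* `geomDirDim_le_of_canonicalNearStep_of_stateGood'` — generic value of W-mono without the binder;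
* **`closedOriginGeomDirDimNonincrease_holds (p N)`**, **`wmono_holds : ∀ p, p.Prime → ClosedOriginGeomDirDimNonincrease.{0} p 3`**
  (the registered signature of `stub_Wmono` with its binder REMOVED), **`geomDirDimNonincrease_holds (p) : GeomDirDimNonincrease p`**.

NOTHING here is a statement of H. Hironaka's manuscript [Hironaka2017]. AI review is weaker than expert review. References
(orientation only): V. Cossart, U. Jannsen, S. Saito, LNM 2270 (2020), Thm. 3.10 (4), Lemma 5.34 (3), Rem. 18.29 (1); B. Dietel,
Dissertation Regensburg (2015), Satz (8.2.7) (ii).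
-/

noncomputable section

-- single-conjunct summit: the doubled namespace component `ResolutionOfSingularities` is mandated
set_option linter.dupNamespace false

open CategoryTheory AlgebraicGeometry TopologicalSpace IsLocalRing
open Literature.AlgebraicGeometry.Resolution Literature.RingTheory.HilbertSamuel
open Summit.ResolutionOfSingularities.ResolutionOfSingularities.Theorems.SigmaMaxModificationsCorridor3.Helpers

namespace Summit.ResolutionOfSingularities.ResolutionOfSingularities.Theorems

namespace CampaignW42

universe u

/-! ## `ē_{x'}(X') ≤ ē_x(X)` at every near point -/

section Schemes

variable {X X' : Scheme.{u}} [IsLocallyNoetherian X] [IsLocallyNoetherian X'] {π : X' ⟶ X} {D : X.IdealSheafData}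

/-- **`ē_{x'}(X') ≤ ē_{π x'}(X)` at EVERY near point of a permissible blow-up — no binder, no closedness of `x'`, no bound on the
level** (`dim F_{x'} + tr.deg ≤ dim F_x`, `dim F = ē`). [cite: CossartJannsenSaito2020, Thm. 3.10 (4), Rem. 18.29 (1)]
[cite: Dietel2015, Satz (8.2.7) (ii) p. 105] -/
theorem geomDirDim_le_of_isNearPoint (hπ : IsBlowup π D) (x' : X') (hperm : IdealSheafData.IsPermissibleAt D (π.base x'))
    (hUC : IsUniversallyCatenaryRing (X.presheaf.stalk (π.base x'))) {N : ℕ} (hnear : IsNearPoint π N x') :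
    Scheme.geomDirDim X' x' ≤ Scheme.geomDirDim X (π.base x') := by
  have h := ridgeDimDropAt_of_isNearPoint hπ x' hperm hUC hnear
  unfold RidgeDimDropAt at h
  rw [← ridgeDim_eq_geomDirDim, ← ridgeDim_eq_geomDirDim]
  have h' : (Scheme.ridgeDim X' x' : Cardinal.{u}) ≤ (Scheme.ridgeDim X (π.base x') : Cardinal.{u}) :=
    le_trans (self_le_add_right _ _) h
  exact_mod_cast h'

/-- **Drop-in for `geomDirDim_le_of_hsFun_eq_of_isClosed` WITHOUT the binder** (and without `N ≥ dim X`, without closedness):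
`X` excellent, `D` permissible, `π` a blow-up in `D`, `x'` over `V(D)` with `H^N_{X'}(x') = H^N_X(π x')`. [cite: Dietel2015, Satz (8.2.7) (ii) p. 105] -/
theorem geomDirDim_le_of_hsFun_eq_of_isExcellent (hX : Scheme.IsExcellent X) (hD : IdealSheafData.IsPermissible D)
    (hπ : IsBlowup π D) {N : ℕ} {x' : X'} (hx : π.base x' ∈ (D.support : Set X))
    (hnear : Scheme.hsFun X' N x' = Scheme.hsFun X N (π.base x')) :
    Scheme.geomDirDim X' x' ≤ Scheme.geomDirDim X (π.base x') :=
  geomDirDim_le_of_isNearPoint hπ x' (hD _ hx) (hX.isUniversallyCatenaryRing_stalk _) hnear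

end Schemes

/-! ## W-MONO without the binder -/

variable {R : ∀ S : Scheme.{u}, CentreSeq S → Prop} {N : ℕ} {ν : ℕ → ℕ}

/-- **Generic value of W-mono, unconditionally** (`…Corridor3WMono`'s `geomDirDim_le_of_canonicalNearStep_of_stateGood` with the
binder CJS Thm. 3.10 (4) replaced by `geomDirDim_le_of_isNearPoint`). [cite: CossartJannsenSaito2020, Lemma 5.34 (3)]
[cite: Dietel2015, Satz (8.2.7) (ii) p. 105] -/
theorem geomDirDim_le_of_canonicalNearStep_of_stateGood' {k : Type u} [Field k] {s s' : MarkedStage.{u}}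
    (hgood : StateGood k R N ν s.W s.L s.P) (hmem : s.pt ∈ Scheme.hsStratum s.W N ν) (hst : CanonicalNearStep R N ν s s') :
    s'.geomDirDim ≤ s.geomDirDim := by
  obtain ⟨C, P', hln, x', hcs, hπ, -, hx'ν, rfl⟩ := hst
  haveI : IsLocallyNoetherian s.W := s.ln
  haveI : IsLocallyNoetherian (blowup C) := hln
  show Scheme.geomDirDim (blowup C) x' ≤ Scheme.geomDirDim s.W s.pt
  by_cases hxC : s.pt ∈ (C.support : Set s.W)
  · -- over the centre: the unconditional monotonicity at the near point `x'`
    have hnear : Scheme.hsFun (blowup C) N x' = Scheme.hsFun s.W N ((blowup.π C).base x') := by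
      rw [Scheme.mem_hsStratum_iff.mp hx'ν, hπ]
      exact (Scheme.mem_hsStratum_iff.mp hmem).symm
    have hle := geomDirDim_le_of_hsFun_eq_of_isExcellent hgood.isExcellent (hgood.isPermissible hcs) (blowup.isBlowup C)
      (x' := x') (hπ.symm ▸ hxC) hnear
    rwa [hπ] at hle
  · -- off the centre: the blow-up is a local isomorphism at `x'`
    rw [← hπ] at hxC ⊢
    exact (geomDirDim_blowup_eq_of_notMem_support C x' hxC).le

/-- **W-MONO for every `p` and every level `N`, UNCONDITIONALLY** (`Helpers.ClosedOriginGeomDirDimNonincrease p N`): along a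
canonical near step from a stage reached from a maximal origin, `ē` does not increase. [OURS · L1 W4.2] replaces the role of CJS
Thm. 3.10 (4) + Lemma 5.34 (3) for the line `w_ladder`; NOT a statement of the manuscript. [cite: CossartJannsenSaito2020, Lemma 5.34 (3)]
[cite: Dietel2015, Satz (8.2.7) (ii) p. 105] -/
theorem closedOriginGeomDirDimNonincrease_holds (p N : ℕ) : ClosedOriginGeomDirDimNonincrease.{u} p N := by
  intro R _ hRa ν s s' hsc hst
  obtain ⟨X, hXln, x, hX, hreach⟩ := hsc
  by_cases hν : ν = iterPSum N Phi
  · -- degenerate value: the marked point is a regular point of its stage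
    have hmem := SigmaMaxModificationsCorridor3.Moving.pt_mem_hsStratum_of_reaches (R := R) hX.mem_stratum hreach
    haveI : IsLocallyNoetherian s.W := s.ln
    have hreg : s.pt ∈ Scheme.regularLocus s.W := by
      have hmem' : Scheme.hsFun s.W N s.pt = iterPSum N Phi := hν ▸ Scheme.mem_hsStratum_iff.mp hmem
      exact ((Scheme.hsFun_eq_iterPSum_Phi_iff N s.pt).mp hmem').1
    exact geomDirDim_le_of_canonicalNearStep_of_mem_regularLocus hreg hst
  · obtain ⟨k, _, h0⟩ := exists_stateGood_init_of_isMaximalOrigin hX hν hRa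
    obtain ⟨hgood, hmem⟩ := stateGood_and_mem_of_reaches (s₀ := MarkedStage.init X x) h0 hX.mem_stratum hreach
    exact geomDirDim_le_of_canonicalNearStep_of_stateGood' hgood hmem hst

/-- **The registered signature of `stub_Wmono` (skeleton `w_ladder`, stmt-ResolutionOfSingularities-19249) with its binder REMOVED:
`∀ p, p.Prime → ClosedOriginGeomDirDimNonincrease.{0} p 3`.** [OURS · L1 W4.2]; NOT a statement of the manuscript.
[cite: Dietel2015, Satz (8.2.7) (ii) p. 105] -/
theorem wmono_holds : ∀ p : ℕ, p.Prime → ClosedOriginGeomDirDimNonincrease.{0} p 3 :=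
  fun p _ => closedOriginGeomDirDimNonincrease_holds p 3

/-- **The s42 assembly hypothesis `CampaignW42.GeomDirDimNonincrease p` holds for every `p`, UNCONDITIONALLY** (isolated origins are
maximal origins). [OURS · L1 W4.2]; NOT a statement of the manuscript. [cite: Dietel2015, Satz (8.2.7) (ii) p. 105]
[cite: CossartJannsenSaito2020, Rem. 18.29 (1)] -/
theorem geomDirDimNonincrease_holds (p : ℕ) : GeomDirDimNonincrease.{u} p := by
  intro R hRf hRa N ν s s' hsc hst
  obtain ⟨X, hXln, x, hX, hreach⟩ := hsc
  exact closedOriginGeomDirDimNonincrease_holds p N R hRf hRa ν s s' ⟨X, hXln, x, hX.isMaximalOrigin, hreach⟩ hst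

end CampaignW42

end Summit.ResolutionOfSingularities.ResolutionOfSingularities.Theorems

end
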